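import Summits.BirchSwinnertonDyer.Rank1Residual.X12.CubeSumFamiliesRecords
import Summits.BirchSwinnertonDyer.Rank1Residual.X12.JZeroThreeDescent
import HarnessLib

/-!
# Route PrintCFram, regime T (`LocalThreeTorsionBSDThree`, stmt-BirchSwinnertonDyer-20699): the 13
# beyond-window cube-sum classes reached by print — their PARTNER members as kernel records,
# part A: Hu–Shu–Yin and Shu–Yin classes (cell `bsd-print-cfram`, seat p4 g3; display, supports 20699)

HONEST FRAMING (cell `bsd-print-cfram`, run/shared/lean/pub/bsd-print-cfram/, D-0131 (2) print
tier; verbatim in every file of the seat): the cell works the partition leaf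
`CornerF ∧ p ramified in the CM field K` (LADDER-BSD row K7r = B13; W-ALL row 12r) in PARTITION
currency — a leaf or a cell counts only when its theorem is in the kernel BY NAME. Nothing class-wide
is closed here. The seat's T-PRINT CENSUS (kit j285547, HOME/p4/g3/T-PRINT-CENSUS.md, evidence on
stmt-…-20699) found that exactly 19 of the 178 regime-T_cube classes `N < 5·10⁵` are reached by a
PRINTED rank-one `3`-part family, all 19 with kernel records by name — for the 13 beyond-window ones
(b2b `X12/CubeSumFamiliesRecords.lean`) on the cube-sum member `E_n` / `C_{2p^j}` only. THIS FILE adds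
the OTHER member of each of those 13 two-curve isogeny classes — the `3`-isogenous partner
`E_n / ⟨(0, ±√k)⟩` — as an explicit globally minimal equation with `IsElliptic` / `IsGloballyMinimal`
DECIDED in the kernel, its Vélu `3`-isogeny to the printed model PROVED
(`isIsogenous_partner_of_halfScale`, `isIsogenous_partner_cubeSumTwoModel`: tree `isIsogenous_mk_a₆` +
`halfScale_smul`), and `r_an = 1 ∧ BSD(·, 3)` from b2b's isogeny-class consumers
(`CubeSumFamilies.bsdp_three_of_isIsogenous_sylvester / _cubeSumTwoModel / _cubeSum_three_mul(_sq)`: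
the family fact + Burungale–Flach Cor. 2 + modularity + Cassels + GZK where printed needs it), plus
the leaf cell `CornerF · 3` by name (`j = 0`, `r_an = 1` now PROVED from the family fact). Models:
partner of `E_n` (`n` odd) is `y² = x³ + 16n² ≅ [0,0,1,0,(n²−1)/4]`; partner of `C_{2p^j} = [0,0,0,0,−27p^{2j}]`
is `[0,0,0,0,p^{2j}]`. Cremona labels in docstrings are orientation only (census j284048 / j285547).
Theorems + 13 explicit equations (data); no named fact; net Literature debt 0. beyond-print: NO.

References: `X12/CubeSumFamilies{,Records}.lean` (b2b); HOME/p4/g3/T-PRINT-CENSUS.md;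
[cite: HuShuYin2019, Thm. 1.4]; [cite: KezukaLi2020, Cor. 1.2 and (4.1)]; [cite: ShuYin2022, Thm. 1.2];
[cite: BurungaleFlach2024, Cor. 2]; [cite: SilvermanAEC2009, III.4 Remark 4.13.3, VII.1 Remark 1.1];
[cite: MilneADT2006, Thm. I.7.3].
-/

set_option linter.dupNamespace false
set_option autoImplicit false

noncomputable section

open scoped Classical

open WeierstrassCurve Literature.NumberTheory.EllipticCurves
  Literature.NumberTheory.EllipticCurves.Rank1Residual
  Literature.NumberTheory.EllipticCurves.HuShuYin2019
  Literature.NumberTheory.EllipticCurves.Rank1Residual.X12CubeSum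
  Summit.BirchSwinnertonDyer.Rank1Residual Summit.BirchSwinnertonDyer.Rank1Residual.X12

namespace Summit.BirchSwinnertonDyer.BirchSwinnertonDyer.Theorems.PrintCFram.CubeSumPartners

/-! ## §1 The two Vélu `3`-isogenies, once -/

/-- **Partner of `E_n`.** If `64a + 16 = 16n²` (`n ≠ 0`) then `y² + y = x³ + a` — i.e. `y² = x³ + 16n²`
after `halfScale` — is `ℚ`-isogenous to `E_n : y² = x³ − 432n²` (Vélu's `3`-isogeny with kernel
`⟨(0, ±4n)⟩`, tree `isIsogenous_mk_a₆`). [cite: SilvermanAEC2009, III.4 Remark 4.13.3 (Vélu)] -/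
theorem isIsogenous_partner_of_halfScale (a n : ℚ) (h : 64 * a + 16 = 16 * n ^ 2) (hn : n ≠ 0) :
    IsIsogenous (⟨0, 0, 1, 0, a⟩ : WeierstrassCurve ℚ) (cubeSumCurve n) := by
  have h1 : IsIsogenous (⟨0, 0, 1, 0, a⟩ : WeierstrassCurve ℚ) ⟨0, 0, 0, 0, 64 * a + 16⟩ :=
    isIsogenous_of_smul_eq (halfScale_smul a)
  have hc : (16 * n ^ 2 : ℚ) ≠ 0 := mul_ne_zero (by norm_num) (pow_ne_zero _ hn)
  have h2 : IsIsogenous (⟨0, 0, 0, 0, 16 * n ^ 2⟩ : WeierstrassCurve ℚ)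
      ⟨0, 0, 0, 0, -27 * (16 * n ^ 2)⟩ := isIsogenous_mk_a₆ hc
  have e : (⟨0, 0, 0, 0, -27 * (16 * n ^ 2)⟩ : WeierstrassCurve ℚ) = cubeSumCurve n := by
    simp only [cubeSumCurve]; ring_nf
  rw [h] at h1
  rw [e] at h2
  exact h1.trans' h2

/-- **Partner of `C_{2p^j}`.** `y² = x³ + p^{2j}` is `ℚ`-isogenous to Kezuka–Li's model
`C_{2p^j} : y² = x³ − 27p^{2j}` (Vélu's `3`-isogeny with kernel `⟨(0, ±p^j)⟩`).
[cite: SilvermanAEC2009, III.4 Remark 4.13.3 (Vélu)] [cite: KezukaLi2020, (4.1) (p. 2139)] -/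
theorem isIsogenous_partner_cubeSumTwoModel {p : ℕ} (hp : p ≠ 0) (j : ℕ) :
    IsIsogenous (⟨0, 0, 0, 0, (p : ℚ) ^ (2 * j)⟩ : WeierstrassCurve ℚ)
      (KezukaLi2020.cubeSumTwoModel p j) := by
  have hc : ((p : ℚ) ^ (2 * j)) ≠ 0 := pow_ne_zero _ (Nat.cast_ne_zero.mpr hp)
  simpa [KezukaLi2020.cubeSumTwoModel] using isIsogenous_mk_a₆ hc

/-- `j = 0` when `a₁ = a₂ = a₄ = 0` (`c₄ = b₂² − 24b₄ = 0`). [cite: SilvermanAEC2009, III.1] -/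
theorem j_eq_zero_of_a₁_a₂_a₄ (W : WeierstrassCurve ℚ) [W.IsElliptic] (h1 : W.a₁ = 0)
    (h2 : W.a₂ = 0) (h4 : W.a₄ = 0) : W.j = 0 := by
  have hc4 : W.c₄ = 0 := by
    simp [WeierstrassCurve.c₄, WeierstrassCurve.b₂, WeierstrassCurve.b₄, h1, h2, h4]
  rw [WeierstrassCurve.j, hc4]
  simp

/-! ## §2 Hu–Shu–Yin partners: `E_n/⟨(0,±√k)⟩ ≅ y² = x³ + 16n²`, `n ∈ {31, 79, 97, 223}` -/

section HuShuYin

/-- Partner of `E_31` in class 25947a (Cremona 25947a1): `y² + y = x³ + 240` (`64·240 + 16 = 16·31²`).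
[cite: HuShuYin2019, p. 4] -/
def cubeSum31Partner : WeierstrassCurve ℚ := ⟨0, 0, 1, 0, 240⟩
/-- `cubeSum31Partner` is elliptic (`Δ = −27·31⁴ ≠ 0`). [cite: SilvermanAEC2009, III.1] -/
instance isElliptic_cubeSum31Partner : cubeSum31Partner.IsElliptic := isElliptic_mk (by norm_num)
/-- `[0,0,1,0,240]` is globally minimal (`b₆ = 31²`, `Δ = −27·31⁴`). [cite: SilvermanAEC2009, VII.1 Remark 1.1] -/
instance isGloballyMinimal_cubeSum31Partner : cubeSum31Partner.IsGloballyMinimal := by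
  have := isGloballyMinimal_mk 1 240 60 (by norm_num) (by norm_num) (by norm_num) (by decide)
  simpa [cubeSum31Partner] using this
/-- The Vélu `3`-isogeny `cubeSum31Partner → E_31`. [cite: SilvermanAEC2009, III.4 Remark 4.13.3 (Vélu)] -/
theorem isIsogenous_cubeSum31Partner : IsIsogenous cubeSum31Partner (cubeSumCurve ((31 : ℕ) : ℚ)) := by
  simpa [cubeSum31Partner] using isIsogenous_partner_of_halfScale 240 31 (by norm_num) (by norm_num)
/-- **Partner of `E_31` (class 25947a): `r_an = 1 ∧ BSD(·, 3)`** from Hu–Shu–Yin Thm. 1.4 (`p = 31`) through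
the isogeny class (Burungale–Flach, modularity, Cassels). [cite: HuShuYin2019, Thm. 1.4] [cite: BurungaleFlach2024, Cor. 2]
[cite: MilneADT2006, Thm. I.7.3] -/
theorem bsdp_three_cubeSum31Partner (hHSY : thm14_threePart_product)
    (hCM0 : bsdTriple_of_hasCM_of_L_one_ne_zero) (hmod : hasEntireLFunction_rat)
    (hCassels : bsdRHS_eq_of_isIsogenous) :
    cubeSum31Partner.analyticRank = 1 ∧ BSDp cubeSum31Partner 3 :=
  CubeSumFamilies.bsdp_three_of_isIsogenous_sylvester hHSY hCM0 hmod hCassels (p := 31) (by norm_num)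
    CubeSumFamilies.hypotheses_hsy.1.1 CubeSumFamilies.hypotheses_hsy.1.2 _ isIsogenous_cubeSum31Partner
/-- **`(25947a1, 3)` is a cell of the leaf `CornerF ∧ CMRamified` at `3`** — `r_an = 1` PROVED from the print.
[cite: HuShuYin2019, Thm. 1.4] -/
theorem cornerF_three_cubeSum31Partner (hHSY : thm14_threePart_product)
    (hCM0 : bsdTriple_of_hasCM_of_L_one_ne_zero) (hmod : hasEntireLFunction_rat)
    (hCassels : bsdRHS_eq_of_isIsogenous) : CornerF cubeSum31Partner 3 :=
  JZeroThree.cornerF_three_of_j_eq_zero _ (j_eq_zero_of_a₁_a₂_a₄ cubeSum31Partner rfl rfl rfl)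
    (bsdp_three_cubeSum31Partner hHSY hCM0 hmod hCassels).1

/-- Partner of `E_79` in class 56169a (Cremona 56169a1): `y² + y = x³ + 1560` (`64·1560 + 16 = 16·79²`).
[cite: HuShuYin2019, p. 4] -/
def cubeSum79Partner : WeierstrassCurve ℚ := ⟨0, 0, 1, 0, 1560⟩
/-- `cubeSum79Partner` is elliptic (`Δ = −27·79⁴ ≠ 0`). [cite: SilvermanAEC2009, III.1] -/
instance isElliptic_cubeSum79Partner : cubeSum79Partner.IsElliptic := isElliptic_mk (by norm_num)
/-- `[0,0,1,0,1560]` is globally minimal (`b₆ = 79²`, `Δ = −27·79⁴`). [cite: SilvermanAEC2009, VII.1 Remark 1.1] -/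
instance isGloballyMinimal_cubeSum79Partner : cubeSum79Partner.IsGloballyMinimal := by
  have := isGloballyMinimal_mk 1 1560 60 (by norm_num) (by norm_num) (by norm_num) (by decide)
  simpa [cubeSum79Partner] using this
/-- The Vélu `3`-isogeny `cubeSum79Partner → E_79`. [cite: SilvermanAEC2009, III.4 Remark 4.13.3 (Vélu)] -/
theorem isIsogenous_cubeSum79Partner : IsIsogenous cubeSum79Partner (cubeSumCurve ((79 : ℕ) : ℚ)) := by
  simpa [cubeSum79Partner] using isIsogenous_partner_of_halfScale 1560 79 (by norm_num) (by norm_num)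
/-- **Partner of `E_79` (class 56169a): `r_an = 1 ∧ BSD(·, 3)`** from Hu–Shu–Yin Thm. 1.4 (`p = 79`) through
the isogeny class (Burungale–Flach, modularity, Cassels). [cite: HuShuYin2019, Thm. 1.4] [cite: BurungaleFlach2024, Cor. 2]
[cite: MilneADT2006, Thm. I.7.3] -/
theorem bsdp_three_cubeSum79Partner (hHSY : thm14_threePart_product)
    (hCM0 : bsdTriple_of_hasCM_of_L_one_ne_zero) (hmod : hasEntireLFunction_rat)
    (hCassels : bsdRHS_eq_of_isIsogenous) :
    cubeSum79Partner.analyticRank = 1 ∧ BSDp cubeSum79Partner 3 :=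
  CubeSumFamilies.bsdp_three_of_isIsogenous_sylvester hHSY hCM0 hmod hCassels (p := 79) (by norm_num)
    CubeSumFamilies.hypotheses_hsy.2.1.1 CubeSumFamilies.hypotheses_hsy.2.1.2 _ isIsogenous_cubeSum79Partner
/-- **`(56169a1, 3)` is a cell of the leaf `CornerF ∧ CMRamified` at `3`** — `r_an = 1` PROVED from the print.
[cite: HuShuYin2019, Thm. 1.4] -/
theorem cornerF_three_cubeSum79Partner (hHSY : thm14_threePart_product)
    (hCM0 : bsdTriple_of_hasCM_of_L_one_ne_zero) (hmod : hasEntireLFunction_rat)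
    (hCassels : bsdRHS_eq_of_isIsogenous) : CornerF cubeSum79Partner 3 :=
  JZeroThree.cornerF_three_of_j_eq_zero _ (j_eq_zero_of_a₁_a₂_a₄ cubeSum79Partner rfl rfl rfl)
    (bsdp_three_cubeSum79Partner hHSY hCM0 hmod hCassels).1

/-- Partner of `E_97` in class 84681b (Cremona 84681b1): `y² + y = x³ + 2352` (`64·2352 + 16 = 16·97²`).
[cite: HuShuYin2019, p. 4] -/
def cubeSum97Partner : WeierstrassCurve ℚ := ⟨0, 0, 1, 0, 2352⟩
/-- `cubeSum97Partner` is elliptic (`Δ = −27·97⁴ ≠ 0`). [cite: SilvermanAEC2009, III.1] -/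
instance isElliptic_cubeSum97Partner : cubeSum97Partner.IsElliptic := isElliptic_mk (by norm_num)
/-- `[0,0,1,0,2352]` is globally minimal (`b₆ = 97²`, `Δ = −27·97⁴`). [cite: SilvermanAEC2009, VII.1 Remark 1.1] -/
instance isGloballyMinimal_cubeSum97Partner : cubeSum97Partner.IsGloballyMinimal := by
  have := isGloballyMinimal_mk 1 2352 60 (by norm_num) (by norm_num) (by norm_num) (by decide)
  simpa [cubeSum97Partner] using this
/-- The Vélu `3`-isogeny `cubeSum97Partner → E_97`. [cite: SilvermanAEC2009, III.4 Remark 4.13.3 (Vélu)] -/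
theorem isIsogenous_cubeSum97Partner : IsIsogenous cubeSum97Partner (cubeSumCurve ((97 : ℕ) : ℚ)) := by
  simpa [cubeSum97Partner] using isIsogenous_partner_of_halfScale 2352 97 (by norm_num) (by norm_num)
/-- **Partner of `E_97` (class 84681b): `r_an = 1 ∧ BSD(·, 3)`** from Hu–Shu–Yin Thm. 1.4 (`p = 97`) through
the isogeny class (Burungale–Flach, modularity, Cassels). [cite: HuShuYin2019, Thm. 1.4] [cite: BurungaleFlach2024, Cor. 2]
[cite: MilneADT2006, Thm. I.7.3] -/
theorem bsdp_three_cubeSum97Partner (hHSY : thm14_threePart_product)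
    (hCM0 : bsdTriple_of_hasCM_of_L_one_ne_zero) (hmod : hasEntireLFunction_rat)
    (hCassels : bsdRHS_eq_of_isIsogenous) :
    cubeSum97Partner.analyticRank = 1 ∧ BSDp cubeSum97Partner 3 :=
  CubeSumFamilies.bsdp_three_of_isIsogenous_sylvester hHSY hCM0 hmod hCassels (p := 97) (by norm_num)
    CubeSumFamilies.hypotheses_hsy.2.2.1.1 CubeSumFamilies.hypotheses_hsy.2.2.1.2 _ isIsogenous_cubeSum97Partner
/-- **`(84681b1, 3)` is a cell of the leaf `CornerF ∧ CMRamified` at `3`** — `r_an = 1` PROVED from the print.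
[cite: HuShuYin2019, Thm. 1.4] -/
theorem cornerF_three_cubeSum97Partner (hHSY : thm14_threePart_product)
    (hCM0 : bsdTriple_of_hasCM_of_L_one_ne_zero) (hmod : hasEntireLFunction_rat)
    (hCassels : bsdRHS_eq_of_isIsogenous) : CornerF cubeSum97Partner 3 :=
  JZeroThree.cornerF_three_of_j_eq_zero _ (j_eq_zero_of_a₁_a₂_a₄ cubeSum97Partner rfl rfl rfl)
    (bsdp_three_cubeSum97Partner hHSY hCM0 hmod hCassels).1

/-- Partner of `E_223` in class 447561c (Cremona 447561c1): `y² + y = x³ + 12432` (`64·12432 + 16 = 16·223²`).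
[cite: HuShuYin2019, p. 4] -/
def cubeSum223Partner : WeierstrassCurve ℚ := ⟨0, 0, 1, 0, 12432⟩
/-- `cubeSum223Partner` is elliptic (`Δ = −27·223⁴ ≠ 0`). [cite: SilvermanAEC2009, III.1] -/
instance isElliptic_cubeSum223Partner : cubeSum223Partner.IsElliptic := isElliptic_mk (by norm_num)
/-- `[0,0,1,0,12432]` is globally minimal (`b₆ = 223²`, `Δ = −27·223⁴`). [cite: SilvermanAEC2009, VII.1 Remark 1.1] -/
instance isGloballyMinimal_cubeSum223Partner : cubeSum223Partner.IsGloballyMinimal := by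
  have := isGloballyMinimal_mk 1 12432 60 (by norm_num) (by norm_num) (by norm_num) (by decide)
  simpa [cubeSum223Partner] using this
/-- The Vélu `3`-isogeny `cubeSum223Partner → E_223`. [cite: SilvermanAEC2009, III.4 Remark 4.13.3 (Vélu)] -/
theorem isIsogenous_cubeSum223Partner : IsIsogenous cubeSum223Partner (cubeSumCurve ((223 : ℕ) : ℚ)) := by
  simpa [cubeSum223Partner] using isIsogenous_partner_of_halfScale 12432 223 (by norm_num) (by norm_num)
/-- **Partner of `E_223` (class 447561c): `r_an = 1 ∧ BSD(·, 3)`** from Hu–Shu–Yin Thm. 1.4 (`p = 223`) through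
the isogeny class (Burungale–Flach, modularity, Cassels). [cite: HuShuYin2019, Thm. 1.4] [cite: BurungaleFlach2024, Cor. 2]
[cite: MilneADT2006, Thm. I.7.3] -/
theorem bsdp_three_cubeSum223Partner (hHSY : thm14_threePart_product)
    (hCM0 : bsdTriple_of_hasCM_of_L_one_ne_zero) (hmod : hasEntireLFunction_rat)
    (hCassels : bsdRHS_eq_of_isIsogenous) :
    cubeSum223Partner.analyticRank = 1 ∧ BSDp cubeSum223Partner 3 :=
  CubeSumFamilies.bsdp_three_of_isIsogenous_sylvester hHSY hCM0 hmod hCassels (p := 223) (by norm_num)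
    CubeSumFamilies.hypotheses_hsy.2.2.2.1 CubeSumFamilies.hypotheses_hsy.2.2.2.2 _ isIsogenous_cubeSum223Partner
/-- **`(447561c1, 3)` is a cell of the leaf `CornerF ∧ CMRamified` at `3`** — `r_an = 1` PROVED from the print.
[cite: HuShuYin2019, Thm. 1.4] -/
theorem cornerF_three_cubeSum223Partner (hHSY : thm14_threePart_product)
    (hCM0 : bsdTriple_of_hasCM_of_L_one_ne_zero) (hmod : hasEntireLFunction_rat)
    (hCassels : bsdRHS_eq_of_isIsogenous) : CornerF cubeSum223Partner 3 :=
  JZeroThree.cornerF_three_of_j_eq_zero _ (j_eq_zero_of_a₁_a₂_a₄ cubeSum223Partner rfl rfl rfl)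
    (bsdp_three_cubeSum223Partner hHSY hCM0 hmod hCassels).1

end HuShuYin

/-! ## §3 Shu–Yin partners: `E_n/⟨(0,±√k)⟩ ≅ y² = x³ + 16n²`, `n ∈ {3·11², 3·23, 3·29², 3·41}` -/

section ShuYin

/-- Partner of `E_{363} = E_{3·11²}` in class 29403g (Cremona 29403g1): `y² + y = x³ + 32942` (`64·32942 + 16 = 16·363²`).
[cite: ShuYin2022, Thm. 1.2] -/
def cubeSum363Partner : WeierstrassCurve ℚ := ⟨0, 0, 1, 0, 32942⟩
/-- `cubeSum363Partner` is elliptic. [cite: SilvermanAEC2009, III.1] -/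
instance isElliptic_cubeSum363Partner : cubeSum363Partner.IsElliptic := isElliptic_mk (by norm_num)
/-- `[0,0,1,0,32942]` is globally minimal (`b₆ = 363²`). [cite: SilvermanAEC2009, VII.1 Remark 1.1] -/
instance isGloballyMinimal_cubeSum363Partner : cubeSum363Partner.IsGloballyMinimal := by
  have := isGloballyMinimal_mk 1 32942 60 (by norm_num) (by norm_num) (by norm_num) (by decide)
  simpa [cubeSum363Partner] using this
/-- The Vélu `3`-isogeny `cubeSum363Partner → E_{363}`. [cite: SilvermanAEC2009, III.4 Remark 4.13.3 (Vélu)] -/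
theorem isIsogenous_cubeSum363Partner : IsIsogenous cubeSum363Partner (cubeSumCurve (3 * ((11 : ℕ) : ℚ) ^ 2)) := by
  have h := isIsogenous_partner_of_halfScale 32942 363 (by norm_num) (by norm_num)
  norm_num at h ⊢
  simpa [cubeSum363Partner] using h
/-- **Partner of `E_{363}` (class 29403g): `r_an = 1 ∧ BSD(·, 3)`** from Shu–Yin Thm. 1.2 (`p = 11 ≡ 2 mod 9`)
through the isogeny class (Burungale–Flach, modularity, Cassels, GZK). [cite: ShuYin2022, Thm. 1.2]
[cite: BurungaleFlach2024, Cor. 2] [cite: MilneADT2006, Thm. I.7.3] -/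
theorem bsdp_three_cubeSum363Partner (hSY : ShuYin2022.thm12_threePart_product)
    (hCM0 : bsdTriple_of_hasCM_of_L_one_ne_zero) (hmod : hasEntireLFunction_rat)
    (hCassels : bsdRHS_eq_of_isIsogenous) (hGZK : rank_eq_analyticRank_of_analyticRank_le_one) :
    cubeSum363Partner.analyticRank = 1 ∧ BSDp cubeSum363Partner 3 :=
  CubeSumFamilies.bsdp_three_of_isIsogenous_cubeSum_three_mul_sq hSY hCM0 hmod hCassels hGZK
    (p := 11) (by norm_num) (by norm_num) (by norm_num) _ isIsogenous_cubeSum363Partner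
/-- **`(29403g1, 3)` is a cell of the leaf `CornerF ∧ CMRamified` at `3`** — `r_an = 1` PROVED from the print.
[cite: ShuYin2022, Thm. 1.2] -/
theorem cornerF_three_cubeSum363Partner (hSY : ShuYin2022.thm12_threePart_product)
    (hCM0 : bsdTriple_of_hasCM_of_L_one_ne_zero) (hmod : hasEntireLFunction_rat)
    (hCassels : bsdRHS_eq_of_isIsogenous) (hGZK : rank_eq_analyticRank_of_analyticRank_le_one) :
    CornerF cubeSum363Partner 3 :=
  JZeroThree.cornerF_three_of_j_eq_zero _ (j_eq_zero_of_a₁_a₂_a₄ cubeSum363Partner rfl rfl rfl)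
    (bsdp_three_cubeSum363Partner hSY hCM0 hmod hCassels hGZK).1

/-- Partner of `E_{69} = E_{3·23}` in class 128547o (Cremona 128547o1): `y² + y = x³ + 1190` (`64·1190 + 16 = 16·69²`).
[cite: ShuYin2022, Thm. 1.2] -/
def cubeSum69Partner : WeierstrassCurve ℚ := ⟨0, 0, 1, 0, 1190⟩
/-- `cubeSum69Partner` is elliptic. [cite: SilvermanAEC2009, III.1] -/
instance isElliptic_cubeSum69Partner : cubeSum69Partner.IsElliptic := isElliptic_mk (by norm_num)
/-- `[0,0,1,0,1190]` is globally minimal (`b₆ = 69²`). [cite: SilvermanAEC2009, VII.1 Remark 1.1] -/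
instance isGloballyMinimal_cubeSum69Partner : cubeSum69Partner.IsGloballyMinimal := by
  have := isGloballyMinimal_mk 1 1190 60 (by norm_num) (by norm_num) (by norm_num) (by decide)
  simpa [cubeSum69Partner] using this
/-- The Vélu `3`-isogeny `cubeSum69Partner → E_{69}`. [cite: SilvermanAEC2009, III.4 Remark 4.13.3 (Vélu)] -/
theorem isIsogenous_cubeSum69Partner : IsIsogenous cubeSum69Partner (cubeSumCurve (3 * ((23 : ℕ) : ℚ))) := by
  have h := isIsogenous_partner_of_halfScale 1190 69 (by norm_num) (by norm_num)
  norm_num at h ⊢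
  simpa [cubeSum69Partner] using h
/-- **Partner of `E_{69}` (class 128547o): `r_an = 1 ∧ BSD(·, 3)`** from Shu–Yin Thm. 1.2 (`p = 23 ≡ 5 mod 9`)
through the isogeny class (Burungale–Flach, modularity, Cassels, GZK). [cite: ShuYin2022, Thm. 1.2]
[cite: BurungaleFlach2024, Cor. 2] [cite: MilneADT2006, Thm. I.7.3] -/
theorem bsdp_three_cubeSum69Partner (hSY : ShuYin2022.thm12_threePart_product)
    (hCM0 : bsdTriple_of_hasCM_of_L_one_ne_zero) (hmod : hasEntireLFunction_rat)
    (hCassels : bsdRHS_eq_of_isIsogenous) (hGZK : rank_eq_analyticRank_of_analyticRank_le_one) :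
    cubeSum69Partner.analyticRank = 1 ∧ BSDp cubeSum69Partner 3 :=
  CubeSumFamilies.bsdp_three_of_isIsogenous_cubeSum_three_mul hSY hCM0 hmod hCassels hGZK
    (p := 23) (by norm_num) (by norm_num) _ isIsogenous_cubeSum69Partner
/-- **`(128547o1, 3)` is a cell of the leaf `CornerF ∧ CMRamified` at `3`** — `r_an = 1` PROVED from the print.
[cite: ShuYin2022, Thm. 1.2] -/
theorem cornerF_three_cubeSum69Partner (hSY : ShuYin2022.thm12_threePart_product)
    (hCM0 : bsdTriple_of_hasCM_of_L_one_ne_zero) (hmod : hasEntireLFunction_rat)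
    (hCassels : bsdRHS_eq_of_isIsogenous) (hGZK : rank_eq_analyticRank_of_analyticRank_le_one) :
    CornerF cubeSum69Partner 3 :=
  JZeroThree.cornerF_three_of_j_eq_zero _ (j_eq_zero_of_a₁_a₂_a₄ cubeSum69Partner rfl rfl rfl)
    (bsdp_three_cubeSum69Partner hSY hCM0 hmod hCassels hGZK).1

/-- Partner of `E_{2523} = E_{3·29²}` in class 204363e (Cremona 204363e1): `y² + y = x³ + 1591382` (`64·1591382 + 16 = 16·2523²`).
[cite: ShuYin2022, Thm. 1.2] -/
def cubeSum2523Partner : WeierstrassCurve ℚ := ⟨0, 0, 1, 0, 1591382⟩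
/-- `cubeSum2523Partner` is elliptic. [cite: SilvermanAEC2009, III.1] -/
instance isElliptic_cubeSum2523Partner : cubeSum2523Partner.IsElliptic := isElliptic_mk (by norm_num)
/-- `[0,0,1,0,1591382]` is globally minimal (`b₆ = 2523²`). [cite: SilvermanAEC2009, VII.1 Remark 1.1] -/
instance isGloballyMinimal_cubeSum2523Partner : cubeSum2523Partner.IsGloballyMinimal := by
  have := isGloballyMinimal_mk 1 1591382 60 (by norm_num) (by norm_num) (by norm_num) (by decide)
  simpa [cubeSum2523Partner] using this
/-- The Vélu `3`-isogeny `cubeSum2523Partner → E_{2523}`. [cite: SilvermanAEC2009, III.4 Remark 4.13.3 (Vélu)] -/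
theorem isIsogenous_cubeSum2523Partner : IsIsogenous cubeSum2523Partner (cubeSumCurve (3 * ((29 : ℕ) : ℚ) ^ 2)) := by
  have h := isIsogenous_partner_of_halfScale 1591382 2523 (by norm_num) (by norm_num)
  norm_num at h ⊢
  simpa [cubeSum2523Partner] using h
/-- **Partner of `E_{2523}` (class 204363e): `r_an = 1 ∧ BSD(·, 3)`** from Shu–Yin Thm. 1.2 (`p = 29 ≡ 2 mod 9`)
through the isogeny class (Burungale–Flach, modularity, Cassels, GZK). [cite: ShuYin2022, Thm. 1.2]
[cite: BurungaleFlach2024, Cor. 2] [cite: MilneADT2006, Thm. I.7.3] -/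
theorem bsdp_three_cubeSum2523Partner (hSY : ShuYin2022.thm12_threePart_product)
    (hCM0 : bsdTriple_of_hasCM_of_L_one_ne_zero) (hmod : hasEntireLFunction_rat)
    (hCassels : bsdRHS_eq_of_isIsogenous) (hGZK : rank_eq_analyticRank_of_analyticRank_le_one) :
    cubeSum2523Partner.analyticRank = 1 ∧ BSDp cubeSum2523Partner 3 :=
  CubeSumFamilies.bsdp_three_of_isIsogenous_cubeSum_three_mul_sq hSY hCM0 hmod hCassels hGZK
    (p := 29) (by norm_num) (by norm_num) (by norm_num) _ isIsogenous_cubeSum2523Partner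
/-- **`(204363e1, 3)` is a cell of the leaf `CornerF ∧ CMRamified` at `3`** — `r_an = 1` PROVED from the print.
[cite: ShuYin2022, Thm. 1.2] -/
theorem cornerF_three_cubeSum2523Partner (hSY : ShuYin2022.thm12_threePart_product)
    (hCM0 : bsdTriple_of_hasCM_of_L_one_ne_zero) (hmod : hasEntireLFunction_rat)
    (hCassels : bsdRHS_eq_of_isIsogenous) (hGZK : rank_eq_analyticRank_of_analyticRank_le_one) :
    CornerF cubeSum2523Partner 3 :=
  JZeroThree.cornerF_three_of_j_eq_zero _ (j_eq_zero_of_a₁_a₂_a₄ cubeSum2523Partner rfl rfl rfl)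
    (bsdp_three_cubeSum2523Partner hSY hCM0 hmod hCassels hGZK).1

/-- Partner of `E_{123} = E_{3·41}` in class 408483l (Cremona 408483l1): `y² + y = x³ + 3782` (`64·3782 + 16 = 16·123²`).
[cite: ShuYin2022, Thm. 1.2] -/
def cubeSum123Partner : WeierstrassCurve ℚ := ⟨0, 0, 1, 0, 3782⟩
/-- `cubeSum123Partner` is elliptic. [cite: SilvermanAEC2009, III.1] -/
instance isElliptic_cubeSum123Partner : cubeSum123Partner.IsElliptic := isElliptic_mk (by norm_num)
/-- `[0,0,1,0,3782]` is globally minimal (`b₆ = 123²`). [cite: SilvermanAEC2009, VII.1 Remark 1.1] -/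
instance isGloballyMinimal_cubeSum123Partner : cubeSum123Partner.IsGloballyMinimal := by
  have := isGloballyMinimal_mk 1 3782 60 (by norm_num) (by norm_num) (by norm_num) (by decide)
  simpa [cubeSum123Partner] using this
/-- The Vélu `3`-isogeny `cubeSum123Partner → E_{123}`. [cite: SilvermanAEC2009, III.4 Remark 4.13.3 (Vélu)] -/
theorem isIsogenous_cubeSum123Partner : IsIsogenous cubeSum123Partner (cubeSumCurve (3 * ((41 : ℕ) : ℚ))) := by
  have h := isIsogenous_partner_of_halfScale 3782 123 (by norm_num) (by norm_num)
  norm_num at h ⊢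
  simpa [cubeSum123Partner] using h
/-- **Partner of `E_{123}` (class 408483l): `r_an = 1 ∧ BSD(·, 3)`** from Shu–Yin Thm. 1.2 (`p = 41 ≡ 5 mod 9`)
through the isogeny class (Burungale–Flach, modularity, Cassels, GZK). [cite: ShuYin2022, Thm. 1.2]
[cite: BurungaleFlach2024, Cor. 2] [cite: MilneADT2006, Thm. I.7.3] -/
theorem bsdp_three_cubeSum123Partner (hSY : ShuYin2022.thm12_threePart_product)
    (hCM0 : bsdTriple_of_hasCM_of_L_one_ne_zero) (hmod : hasEntireLFunction_rat)
    (hCassels : bsdRHS_eq_of_isIsogenous) (hGZK : rank_eq_analyticRank_of_analyticRank_le_one) :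
    cubeSum123Partner.analyticRank = 1 ∧ BSDp cubeSum123Partner 3 :=
  CubeSumFamilies.bsdp_three_of_isIsogenous_cubeSum_three_mul hSY hCM0 hmod hCassels hGZK
    (p := 41) (by norm_num) (by norm_num) _ isIsogenous_cubeSum123Partner
/-- **`(408483l1, 3)` is a cell of the leaf `CornerF ∧ CMRamified` at `3`** — `r_an = 1` PROVED from the print.
[cite: ShuYin2022, Thm. 1.2] -/
theorem cornerF_three_cubeSum123Partner (hSY : ShuYin2022.thm12_threePart_product)
    (hCM0 : bsdTriple_of_hasCM_of_L_one_ne_zero) (hmod : hasEntireLFunction_rat)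
    (hCassels : bsdRHS_eq_of_isIsogenous) (hGZK : rank_eq_analyticRank_of_analyticRank_le_one) :
    CornerF cubeSum123Partner 3 :=
  JZeroThree.cornerF_three_of_j_eq_zero _ (j_eq_zero_of_a₁_a₂_a₄ cubeSum123Partner rfl rfl rfl)
    (bsdp_three_cubeSum123Partner hSY hCM0 hmod hCassels hGZK).1

end ShuYin

end Summit.BirchSwinnertonDyer.BirchSwinnertonDyer.Theorems.PrintCFram.CubeSumPartners

end
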